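import Summits.BirchSwinnertonDyer.Rank1Residual.Additive.X3GordBranchPAdicGrossZagier
import Summits.BirchSwinnertonDyer.Rank1Residual.Additive.GordBranchPAdicGrossZagierOddConverse
import HarnessLib

/-!
# T-O7c (vii): RIDER ECONOMY — the Schneider rider is NOT needed in the CONVERSE direction
# "`BSD(E,p)` ∧ branch IMC ∧ Delbourgo's (B)-clauses ⟹ the typed branch `p`-adic Gross–Zagier", on
# the (G-ord) rows: defect 2, both parities, big image (Kato) and reducible (X3♯, Wuthrich), EVERY `p`
# of the parity incl. `p = 3`; and the even big-image converse loses its `5 ≤ p` as well (cell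
# `b2b-bsdres`, team n1011, seat p01 GEN 2, OWNERS row T-O7c; rider-free twins of
# `GordBranchPAdicGrossZagier{,Odd}Converse.lean` and `X3GordBranchPAdicGrossZagier.lean` §2)

HONEST FRAMING (cell `b2b-bsdres`, run/shared/lean/b2b/bsd-rank1-residual/, verbatim in every
file): prove what is provable now; shrink each hard class to its core with data; no claim beyond
stated classes. Research routes; census output = EVIDENCE / conjecture items, never a Literature
fact; RESIDUAL-MAP marks change only by signed lines. §I O7 stays OPEN; X3♯(G-ord) / X4♯(G-ord) stay
CONSTRUCTION-SHAPED; nothing is booked; no label changes. COVERAGE (stated first, referee 1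
proviso): the (G-ord) semistable-twist rows of O7-ord — `E = V ⊗ χ_{p*}`, `V` good ordinary, defect 2,
analytic rank `1`, `ℓ_p = 1` (`hna`); even branch `p ≡ 1 (mod 4)`, odd branch `p ≡ 3 (mod 4)` incl.
`p = 3`; X4♯ = `ρ̄_{E,p}` onto (Kato 2004 Thm. 17.4 (3), component / half-eigen reading, published; the
tower of `V` from surj(p) by the PROVED good-ordinary case of Wuthrich 2014 Lemma 20 — hence NO `5 ≤ p`
on either parity), X3♯ = `E[p]` reducible (Wuthrich 2014 Thm. 16, published, NO image hypothesis). NO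
definition, NO Literature fact, NO `_holds`; theorems only.

## What and why

Every converse of this row so far (`…_of_bsdp_…`, gen 1 p253391, gen 2 p254393 / p254539 / p255692 /
p256076) carried the Schneider rider `hS : SchneiderConjecture Dh` (`Reg_p(E,Dh) ≠ 0`, an EVIDENCE
binder). It is REMOVABLE in this direction, by Delbourgo's Theorem (B) clause 2 AS TRANSCRIBED
(`LeadingTermClauses`: `ord_{T=0} fE = rank ↔ (Reg_p(E,Dh) ≠ 0 ∧ Ш[p^∞] finite)`): if `Reg_p(E,Dh) = 0`
then, `Ш[p^∞]` being finite under `BSD(E,p)` and `rank = 1`, `ord fE ≥ 2`, so the UPPER identity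
`ι(k·fE) = C(u·ϖ)·B` forces `ϖ·[T¹]B = 0`, and the typed identity `ϖ·[T¹]B·log_p γ = u'·q·Reg_p(E,Dh)`
holds TRIVIALLY (`0 = 0`, any unit); the complex identity `L'(E,1) = q·Ω_E·Reg_∞` is `BSD(E,p)`'s `#Ш_an`
clause and never needed the rider. So:

* §0 `exists_unit_pgz_of_upper_of_bsdp_of_not_schneider` (the degenerate case: UPPER + (B) clauses
  1–2 + `BSDp` suffice; no LOWER, no `ℓ`) and the rider-free core
  `exists_unit_pgz_of_lower_of_upper_of_bsdp_noRider` (case split; the non-degenerate case is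
  `exists_unit_pgz_of_lower_of_upper_of_bsdp`, `X3GordBranchPAdicGrossZagier.lean` §0).
* §1 big image: `branchPAdicGrossZagier[Odd]At_of_bsdp_of_chiBranchLower[Odd]_of_kato_noRider` — NO `hS`,
  and on the even branch NO `5 ≤ p` either (gen 1's p253391 took `hp5` only for the tower, which the
  odd file already avoided); class forms `ClassX4Gord.…_of_kato[_Half]_noRider`.
* §2 reducible image: `ClassX3Gord.branchPAdicGrossZagier[Odd]At_of_bsdp_of_chiBranchLower[Odd]_of_
  wuthrichHalf_noRider`.
HONEST NOTE on the other direction: the rider (or a weak certificate `[T¹](ϖ·B) ≠ 0`) remains NECESSARY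
for "typed `p`-adic GZ ⟹ `BSD(E,p)`": with `Reg_p(E,Dh) = 0` the typed identity forces `[T¹]B = 0` and
carries no information on `#Ш`. So the iffs of `BranchPAdicGrossZagierIff.lean` keep `hSall`; what this
file adds is that `BSD(E,p)` ALONE (mod branch IMC + (B)) implies the typed identity for EVERY (B)-datum.
The (M) / X3♯(M) twins are the sibling `AdditivePotMult/PotMultBranchPAdicGrossZagierConverseNoRider.lean`.

References: [Delbourgo2002] Thm. (B) (p. 40: order clause and leading term), Hypothesis p. 39;
[Schneider1985] (order of vanishing ≥ rank, equality iff non-degenerate); [Kato2004Asterisque] Thm.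
17.4 (3); [Wuthrich2014] Thm. 16, Lemma 20, §3; [MazurTateTeitelbaum1986Invent] §I.13–I.14;
[Miller2011LMS] Def. 1.1.
-/

noncomputable section

open scoped Classical MatrixGroups ModularForm NumberField

open CongruenceSubgroup WeierstrassCurve NumberField Literature.NumberTheory.EllipticCurves
  Literature.NumberTheory.EllipticCurves.ModularForms
  Literature.NumberTheory.EllipticCurves.Rank1Residual
  Literature.NumberTheory.EllipticCurves.Rank1Residual.Typed
  Literature.NumberTheory.EllipticCurves.Delbourgo2002
  Literature.NumberTheory.GaloisRepresentations
  IsDedekindDomain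

namespace Summit.BirchSwinnertonDyer.Rank1Residual.Additive

variable {W : WeierstrassCurve ℚ} [W.IsElliptic] {p : ℕ} [hp : Fact p.Prime]

/-! ### §0 The degenerate case and the rider-free core -/

/-- **DEGENERATE CASE (cell-agnostic, rank one): `Reg_p(E,Dh) = 0`.** Let `r_an(E) = 1`, `BSD(E,p)`
(Miller: `rank = r_an`, `Ш[p^∞]` finite, `ord_p #Ш = ord_p #Ш_an`), `Dh` a height datum satisfying
Delbourgo's (B)-clauses with `Reg_p(E,Dh) = 0`, `D` a torsion cyclotomic dual datum with generator `fE`,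
and an UPPER identity `ι g = C(u·ϖ)·B` for some `g ∈ char_Λ X` (Kato / Wuthrich). Then clause 2 gives
`ord fE ≠ 1`, clause 1 gives `ord fE ≥ 1`, so `ord fE ≥ 2` and `ϖ·[T¹]B = 0`: the `p`-adic Gross–Zagier
identity holds with `u' = 1` (`0 = 0`), and `L'(E,1) = q·Ω_E·Reg_∞` with `q = #Ш_an·∏c/#T²`. NO LOWER
input, NO `ℓ`, NO modularity. [cite: Delbourgo2002, Theorem (B) (p. 40)] [cite: Miller2011LMS, Def. 1.1] -/
theorem exists_unit_pgz_of_upper_of_bsdp_of_not_schneider (hr : W.analyticRank = 1) (hbsd : BSDp W p)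
    {Dh : PAdicHeightData W p} (hB : LeadingTermClauses W p Dh) (hS : ¬ SchneiderConjecture Dh)
    {κ : ZpExtension ℚ p} {γ : Field.absoluteGaloisGroup ℚ}
    (hκ : κ.IsCyclotomic) (hγ : κ.IsTopGenerator γ) (hγ' : IsCyclotomicVariable p γ)
    (D : W.SelmerDualData κ γ) [Module.Finite (IwasawaAlgebra p) D.X] (hXt : D.IsTorsion)
    {fE g : IwasawaAlgebra p} (hchar : D.charIdeal = Ideal.span {fE}) (hg : g ∈ D.charIdeal)
    {u : ℤ_[p]ˣ} {ϖ : ℚ} {B : PowerSeries ℚ_[p]}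
    (hι : iwasawaToPowerSeries p g = PowerSeries.C (((u : ℤ_[p]) : ℚ_[p]) * (ϖ : ℚ_[p])) * B) :
    ∃ (u' : ℤ_[p]ˣ) (q : ℚ),
      W.leadingLCoeff = (q : ℂ) * (W.realPeriodRat : ℂ) * (W.regulator : ℂ) ∧
      ((ϖ : ℚ) : ℚ_[p]) * PowerSeries.coeff W.mordellWeilRank B *
          padicLog p (cyclotomicGenerator p) ^ W.mordellWeilRank =
        ((u' : ℤ_[p]) : ℚ_[p]) * (q : ℚ_[p]) * padicRegulator Dh := by
  obtain ⟨hrank, hfinp, s, hs, -⟩ := hbsd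
  have hmw : W.mordellWeilRank = 1 := by rw [hrank, hr]
  have hReg : padicRegulator Dh = 0 := by
    by_contra h
    exact hS h
  -- (B) clauses 1–2: `ord fE ≥ 2`
  obtain ⟨hord1, hord2, -⟩ := hB κ γ hκ hγ hγ' D hXt fE hchar
  rw [hmw, Nat.cast_one] at hord1 hord2
  have hne : fE.order ≠ 1 := fun h ↦ hS (hord2.mp h).1
  have hlt : (1 : ℕ∞) < fE.order := lt_of_le_of_ne hord1 (Ne.symm hne)
  have h0 : PowerSeries.constantCoeff fE = 0 := by
    rw [← PowerSeries.coeff_zero_eq_constantCoeff_apply]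
    exact PowerSeries.coeff_of_lt_order 0 (lt_trans (by exact_mod_cast zero_lt_one) hlt)
  have h1 : PowerSeries.coeff 1 fE = 0 := PowerSeries.coeff_of_lt_order 1 (by exact_mod_cast hlt)
  -- UPPER: `ϖ·[T¹]B = 0`
  have hgspan : g ∈ Ideal.span {fE} := by rw [← hchar]; exact hg
  obtain ⟨k, hk⟩ := Ideal.mem_span_singleton'.mp hgspan
  have hιfE0 : PowerSeries.constantCoeff (iwasawaToPowerSeries p fE) = 0 := by
    rw [constantCoeff_iwasawaToPowerSeries, h0, PadicInt.coe_zero]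
  have hιmul : iwasawaToPowerSeries p g = iwasawaToPowerSeries p k * iwasawaToPowerSeries p fE := by
    rw [← hk, map_mul]
  have hL : PowerSeries.coeff 1 (iwasawaToPowerSeries p g) = 0 := by
    rw [hιmul, coeff_one_mul_of_constantCoeff_eq_zero p _ _ hιfE0, Wuthrich2014.coeff_iwasawaToPowerSeries,
      h1, PadicInt.coe_zero, mul_zero]
  have hR : PowerSeries.coeff 1 (iwasawaToPowerSeries p g) =
      ((u : ℤ_[p]) : ℚ_[p]) * (ϖ : ℚ_[p]) * PowerSeries.coeff 1 B := by
    rw [hι, PowerSeries.coeff_C_mul]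
  have hϖB : ((ϖ : ℚ) : ℚ_[p]) * PowerSeries.coeff 1 B = 0 := by
    have h : ((u : ℤ_[p]) : ℚ_[p]) * (((ϖ : ℚ) : ℚ_[p]) * PowerSeries.coeff 1 B) = 0 := by
      rw [← mul_assoc, ← hR, hL]
    exact (mul_eq_zero.mp h).resolve_left (coe_units_ne_zero p u)
  -- the rational `q` (definition of the analytic Ш)
  have hT0 : W.torsionOrder ≠ 0 := (W.torsionOrder_pos_holds).ne'
  have hPpos : 0 < W.tamagawaProduct := W.tamagawaProduct_pos_holds
  have hΩpos : 0 < W.realPeriodRat := W.realPeriodRat_pos_holds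
  have hRegpos : 0 < W.regulator := regulator_pos_holds W
  set q : ℚ := s * (W.tamagawaProduct : ℚ) / (W.torsionOrder : ℚ) ^ 2 with hq_def
  have hlead : W.leadingLCoeff = (q : ℂ) * (W.realPeriodRat : ℂ) * (W.regulator : ℂ) := by
    have hΩC : (W.realPeriodRat : ℂ) ≠ 0 := by exact_mod_cast hΩpos.ne'
    have hRegC : (W.regulator : ℂ) ≠ 0 := by exact_mod_cast hRegpos.ne'
    have hTC : (W.torsionOrder : ℂ) ≠ 0 := by exact_mod_cast hT0
    have hPC : (W.tamagawaProduct : ℂ) ≠ 0 := by exact_mod_cast hPpos.ne'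
    have h := hs
    rw [shaAn_def] at h
    rw [hq_def]
    push_cast
    rw [div_eq_iff (mul_ne_zero (mul_ne_zero hΩC hPC) hRegC)] at h
    field_simp
    linear_combination h
  refine ⟨1, q, hlead, ?_⟩
  rw [hmw, pow_one, hϖB, zero_mul, hReg, mul_zero]

/-- **RIDER-FREE CONVERSE CORE (cell-agnostic, rank one).** As `exists_unit_pgz_of_lower_of_upper_of_bsdp`
(`X3GordBranchPAdicGrossZagier.lean` §0) WITHOUT the Schneider rider: `p ≠ 2`, `r_an(E) = 1`, `BSD(E,p)`,
modularity, a (B)-datum `Dh`, `ℓ_p = 1`, a torsion cyclotomic dual datum with generator `fE`, an UPPER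
identity `ι g = C(u·ϖ)·B` (`g ∈ char`) and a LOWER identity `ι fE = ι h·(ϖ·B)` ⟹ the `p`-adic
Gross–Zagier identity for `(ϖ, B)`. Case `Reg_p ≠ 0`: the core; case `Reg_p = 0`:
`exists_unit_pgz_of_upper_of_bsdp_of_not_schneider`. [cite: Delbourgo2002, Theorem (B) (p. 40)]
[cite: Miller2011LMS, Def. 1.1] -/
theorem exists_unit_pgz_of_lower_of_upper_of_bsdp_noRider (hp2 : p ≠ 2) (hmod : hasEntireLFunction_rat)
    (hr : W.analyticRank = 1) (hbsd : BSDp W p) {Dh : PAdicHeightData W p}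
    (hB : LeadingTermClauses W p Dh) (hna : ReductionNonAnomalous W p)
    {κ : ZpExtension ℚ p} {γ : Field.absoluteGaloisGroup ℚ}
    (hκ : κ.IsCyclotomic) (hγ : κ.IsTopGenerator γ) (hγ' : IsCyclotomicVariable p γ)
    (D : W.SelmerDualData κ γ) [Module.Finite (IwasawaAlgebra p) D.X] (hXt : D.IsTorsion)
    {fE g : IwasawaAlgebra p} (hchar : D.charIdeal = Ideal.span {fE}) (hg : g ∈ D.charIdeal)
    {u : ℤ_[p]ˣ} {ϖ : ℚ} {B : PowerSeries ℚ_[p]}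
    (hι : iwasawaToPowerSeries p g = PowerSeries.C (((u : ℤ_[p]) : ℚ_[p]) * (ϖ : ℚ_[p])) * B)
    {h : IwasawaAlgebra p}
    (hlow : iwasawaToPowerSeries p fE =
      iwasawaToPowerSeries p h * (PowerSeries.C ((ϖ : ℚ) : ℚ_[p]) * B)) :
    ∃ (u' : ℤ_[p]ˣ) (q : ℚ),
      W.leadingLCoeff = (q : ℂ) * (W.realPeriodRat : ℂ) * (W.regulator : ℂ) ∧
      ((ϖ : ℚ) : ℚ_[p]) * PowerSeries.coeff W.mordellWeilRank B *
          padicLog p (cyclotomicGenerator p) ^ W.mordellWeilRank =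
        ((u' : ℤ_[p]) : ℚ_[p]) * (q : ℚ_[p]) * padicRegulator Dh := by
  by_cases hS : SchneiderConjecture Dh
  · exact exists_unit_pgz_of_lower_of_upper_of_bsdp hp2 hmod hr hbsd hB hS hna hκ hγ hγ' D hXt hchar hg hι
      hlow
  · exact exists_unit_pgz_of_upper_of_bsdp_of_not_schneider hr hbsd hB hS hκ hγ hγ' D hXt hchar hg hι

/-! ### §1 Big image (Kato): rider-free converses on the defect-2 (G-ord) rows, both parities -/

/-- **RIDER-FREE CONVERSE (defect 2, EVEN branch `p ≡ 1 (mod 4)`, rank one, EVERY such `p` — NO `5 ≤ p`,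
NO Schneider rider).** `W` potentially good ordinary of type (G) (`TypeGOrd`), `ρ̄_{E,p}` onto, `r_an = 1`,
non-anomalous, `Dh` ANY height datum with Delbourgo's (B)-clauses: `BSD(E,p)` ∧ p07's LOWER
`ChiBranchLowerDivisibilityAt W p` ∧ Kato's component divisibility (`hK`, published) ⟹
`BranchPAdicGrossZagierAt W p Dh`. The tower of `V` from surj(p) ALONE (good-ordinary Lemma 20, proved in
the tree: `forall_hasSurjectiveModNGaloisRep_pow_of_goodOrdinary_of_surj`), so gen 1's `hp5` is gone too.
[cite: Delbourgo2002, Theorem (B) (p. 40)] [cite: Kato2004Asterisque, Thm. 17.4 (3) (p. 273)]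
[cite: Wuthrich2014, Lemma 20 (p. 399)] [cite: Miller2011LMS, Def. 1.1] -/
theorem branchPAdicGrossZagierAt_of_bsdp_of_chiBranchLower_of_kato_noRider
    (hK : Kato2004.charIdeal_dvd_padicLFunctionBranch_component_of_surjective)
    (hmod : hasEntireLFunction_rat) {Dh : PAdicHeightData W p}
    (hB : LeadingTermClauses W p Dh) (hna : ReductionNonAnomalous W p)
    (hG : TypeGOrd W p) (hsurj : Surj W p) (hr : W.analyticRank = 1) (hbsd : BSDp W p)
    (hdiv : ChiBranchLowerDivisibilityAt W p) : BranchPAdicGrossZagierAt W p Dh := by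
  intro V _ _ N _ f hp4 hVW hord hf ϖ hϖ
  have hp2 : p ≠ 2 := by omega
  have heven : Even (p / 2) := ⟨p / 4, by omega⟩
  obtain ⟨C, hC⟩ := hVW
  have hC' : C • V.quadraticTwist ((-1 : ℚ) ^ (p / 2) * p) = W := by
    rw [pStar_eq_self_of_mod_four_eq_one hp4]; exact hC
  obtain ⟨κ, γ, hκ, hγ, hγ', D, fE, hchar⟩ := exists_cyclotomic_dualData_generator W p
  haveI : Module.Finite (IwasawaAlgebra p) D.X :=
    SelmerDualData.module_finite_of_isCyclotomic (W := W) (κ := κ) hκ D hγ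
  -- UPPER (Kato on the component, full series); the tower of `V` from surj(p) of `W`
  have hsV : Surj V p := (surj_iff_of_model_twist V p (pStar_ne_zero p) ⟨C, hC'⟩).mp hsurj
  have hsurjV : ∀ n : ℕ, V.HasSurjectiveModNGaloisRep (p ^ n : ℕ) :=
    V.forall_hasSurjectiveModNGaloisRep_pow_of_goodOrdinary_of_surj p hp2 hord.1 hord.2 hsV
  have hϖ' : (if Even (p / 2) then (ϖ : ℝ) * V.realPeriodRat = plusPeriod f
      else (ϖ : ℝ) * V.imaginaryPeriodRat = minusPeriod f) := by
    rw [if_pos heven]; exact hϖ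
  obtain ⟨hXt, g, hg, u, hι⟩ := isTorsion_and_exists_iota_eq_branch_of_katoComponent W p hK
    (padicValRat_j_nonneg_of_typeGOrd W p hG) hp2 V ⟨C, hC'⟩ (Or.inl hord) hsurjV hκ hγ hγ' hf D ϖ hϖ'
  rw [if_pos heven] at hι
  -- LOWER (p07's typed input)
  obtain ⟨h, hlow⟩ := hdiv V hp4 ⟨C, hC⟩ hord hκ hγ hγ' hf D ϖ hϖ fE
    (by rw [hchar]; exact Ideal.mem_span_singleton_self fE)
  exact exists_unit_pgz_of_lower_of_upper_of_bsdp_noRider hp2 hmod hr hbsd hB hna hκ hγ hγ' D hXt hchar hg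
    hι hlow

/-- **RIDER-FREE CONVERSE (defect 2, ODD branch `p ≡ 3 (mod 4)` incl. `p = 3`, rank one).**
`BSD(E,p)` ∧ (B)-clauses for `Dh` ∧ `ℓ_p = 1` ∧ p07's odd LOWER ∧ Kato (component, published) ⟹
`BranchPAdicGrossZagierOddAt W p Dh` — gen 2's p254393 without `hS`.
[cite: Delbourgo2002, Theorem (B) (p. 40)] [cite: Kato2004Asterisque, Thm. 17.4 (3) (p. 273)]
[cite: Wuthrich2014, Lemma 20 (p. 399)] [cite: Miller2011LMS, Def. 1.1] -/
theorem branchPAdicGrossZagierOddAt_of_bsdp_of_chiBranchLowerOdd_of_kato_noRider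
    (hK : Kato2004.charIdeal_dvd_padicLFunctionBranch_component_of_surjective)
    (hmod : hasEntireLFunction_rat) {Dh : PAdicHeightData W p}
    (hB : LeadingTermClauses W p Dh) (hna : ReductionNonAnomalous W p)
    (hG : TypeGOrd W p) (hsurj : Surj W p) (hr : W.analyticRank = 1) (hbsd : BSDp W p)
    (hdiv : ChiBranchLowerDivisibilityOddAt W p) : BranchPAdicGrossZagierOddAt W p Dh := by
  intro V _ _ N _ f hp4 hVW hord hf ϖ hϖ
  have hp2 : p ≠ 2 := by omega
  have hodd : ¬ Even (p / 2) := by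
    rw [Nat.not_even_iff_odd]
    exact ⟨p / 4, by omega⟩
  obtain ⟨C, hC⟩ := hVW
  have hps : ((-1 : ℚ) ^ (p / 2) * (p : ℚ)) = -(p : ℚ) := by
    rw [pStar_eq_of_mod_four p (Or.inr hp4), if_neg (by omega)]
  have hC' : C • V.quadraticTwist ((-1 : ℚ) ^ (p / 2) * p) = W := by rw [hps]; exact hC
  obtain ⟨κ, γ, hκ, hγ, hγ', D, fE, hchar⟩ := exists_cyclotomic_dualData_generator W p
  haveI : Module.Finite (IwasawaAlgebra p) D.X :=
    SelmerDualData.module_finite_of_isCyclotomic (W := W) (κ := κ) hκ D hγ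
  have hsV : Surj V p := (surj_iff_of_model_twist V p (pStar_ne_zero p) ⟨C, hC'⟩).mp hsurj
  have hsurjV : ∀ n : ℕ, V.HasSurjectiveModNGaloisRep (p ^ n : ℕ) :=
    V.forall_hasSurjectiveModNGaloisRep_pow_of_goodOrdinary_of_surj p hp2 hord.1 hord.2 hsV
  have hϖ' : (if Even (p / 2) then (ϖ : ℝ) * V.realPeriodRat = plusPeriod f
      else (ϖ : ℝ) * V.imaginaryPeriodRat = minusPeriod f) := by
    rw [if_neg hodd]; exact hϖ
  obtain ⟨hXt, g, hg, u, hι⟩ := isTorsion_and_exists_iota_eq_branch_of_katoComponent W p hK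
    (padicValRat_j_nonneg_of_typeGOrd W p hG) hp2 V ⟨C, hC'⟩ (Or.inl hord) hsurjV hκ hγ hγ' hf D ϖ hϖ'
  rw [if_neg hodd] at hι
  obtain ⟨h, hlow⟩ := hdiv V hp4 ⟨C, hC⟩ hord hκ hγ hγ' hf D ϖ hϖ fE
    (by rw [hchar]; exact Ideal.mem_span_singleton_self fE)
  exact exists_unit_pgz_of_lower_of_upper_of_bsdp_noRider hp2 hmod hr hbsd hB hna hκ hγ hγ' D hXt hchar hg
    hι hlow

/-- **Class form, X4♯(G-ord) ∩ `I₀*` ∩ {`ρ̄_{E,p}` onto}, even branch, EVERY `p ≡ 1 (mod 4)`, `r_an = 1`,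
non-anomalous — rider-free and `hp5`-free.** [cite: Delbourgo2002, Theorem (B) (p. 40)]
[cite: Kato2004Asterisque, Thm. 17.4 (3) (p. 273)] [cite: Miller2011LMS, Def. 1.1] -/
theorem ClassX4Gord.branchPAdicGrossZagierAt_of_bsdp_of_chiBranchLower_of_kato_noRider
    (hK : Kato2004.charIdeal_dvd_padicLFunctionBranch_component_of_surjective)
    (hmod : hasEntireLFunction_rat) (hX : ClassX4Gord W p) (hsurj : Surj W p)
    (hr : W.analyticRank = 1) (hna : ReductionNonAnomalous W p) (hbsd : BSDp W p)
    (hdiv : ChiBranchLowerDivisibilityAt W p) {Dh : PAdicHeightData W p}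
    (hB : LeadingTermClauses W p Dh) : BranchPAdicGrossZagierAt W p Dh :=
  Additive.branchPAdicGrossZagierAt_of_bsdp_of_chiBranchLower_of_kato_noRider hK hmod hB hna hX.typeGOrd
    hsurj hr hbsd hdiv

/-- **Class form over the HALF-EIGEN reading of Kato** (even branch), rider-free; the component fact from
the half-eigen one by lit-kato's `…_component_of_surjective_of_half`.
[cite: Kato2004Asterisque, Thm. 17.4 (3) (p. 273)] [cite: Wuthrich2014, Thm. 3 and Cor. 19 (pp. 383, 398)] -/
theorem ClassX4Gord.branchPAdicGrossZagierAt_of_bsdp_of_chiBranchLower_of_katoHalf_noRider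
    (hK : Wuthrich2014.kato_halfEigenCharIdeal_dvd_cyclotomicPrime_of_surjective)
    (hmod : hasEntireLFunction_rat) (hX : ClassX4Gord W p) (hsurj : Surj W p)
    (hr : W.analyticRank = 1) (hna : ReductionNonAnomalous W p) (hbsd : BSDp W p)
    (hdiv : ChiBranchLowerDivisibilityAt W p) {Dh : PAdicHeightData W p}
    (hB : LeadingTermClauses W p Dh) : BranchPAdicGrossZagierAt W p Dh :=
  hX.branchPAdicGrossZagierAt_of_bsdp_of_chiBranchLower_of_kato_noRider
    (Kato2004.charIdeal_dvd_padicLFunctionBranch_component_of_surjective_of_half hK) hmod hsurj hr hna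
    hbsd hdiv hB

/-- **Class form, X4♯(G-ord) ∩ `I₀*` ∩ {`ρ̄_{E,p}` onto}, odd branch, EVERY `p ≡ 3 (mod 4)` incl. `3`,
`r_an = 1`, non-anomalous — rider-free.** [cite: Delbourgo2002, Theorem (B) (p. 40)]
[cite: Kato2004Asterisque, Thm. 17.4 (3) (p. 273)] [cite: Miller2011LMS, Def. 1.1] -/
theorem ClassX4Gord.branchPAdicGrossZagierOddAt_of_bsdp_of_chiBranchLowerOdd_of_kato_noRider
    (hK : Kato2004.charIdeal_dvd_padicLFunctionBranch_component_of_surjective)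
    (hmod : hasEntireLFunction_rat) (hX : ClassX4Gord W p) (hsurj : Surj W p)
    (hr : W.analyticRank = 1) (hna : ReductionNonAnomalous W p) (hbsd : BSDp W p)
    (hdiv : ChiBranchLowerDivisibilityOddAt W p) {Dh : PAdicHeightData W p}
    (hB : LeadingTermClauses W p Dh) : BranchPAdicGrossZagierOddAt W p Dh :=
  Additive.branchPAdicGrossZagierOddAt_of_bsdp_of_chiBranchLowerOdd_of_kato_noRider hK hmod hB hna
    hX.typeGOrd hsurj hr hbsd hdiv

/-- **Class form over the HALF-EIGEN reading of Kato** (odd branch), rider-free.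
[cite: Kato2004Asterisque, Thm. 17.4 (3) (p. 273)] [cite: Wuthrich2014, Thm. 3 and Cor. 19 (pp. 383, 398)] -/
theorem ClassX4Gord.branchPAdicGrossZagierOddAt_of_bsdp_of_chiBranchLowerOdd_of_katoHalf_noRider
    (hK : Wuthrich2014.kato_halfEigenCharIdeal_dvd_cyclotomicPrime_of_surjective)
    (hmod : hasEntireLFunction_rat) (hX : ClassX4Gord W p) (hsurj : Surj W p)
    (hr : W.analyticRank = 1) (hna : ReductionNonAnomalous W p) (hbsd : BSDp W p)
    (hdiv : ChiBranchLowerDivisibilityOddAt W p) {Dh : PAdicHeightData W p}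
    (hB : LeadingTermClauses W p Dh) : BranchPAdicGrossZagierOddAt W p Dh :=
  hX.branchPAdicGrossZagierOddAt_of_bsdp_of_chiBranchLowerOdd_of_kato_noRider
    (Kato2004.charIdeal_dvd_padicLFunctionBranch_component_of_surjective_of_half hK) hmod hsurj hr hna
    hbsd hdiv hB

/-! ### §2 Reducible image (Wuthrich Thm. 16): rider-free converses on X3♯(G-ord), both parities -/

/-- **RIDER-FREE CONVERSE on X3♯(G-ord) (reducible `E[p]`), even branch, EVERY `p ≡ 1 (mod 4)`, rank
one.** `BSD(E,p)` ∧ (B)-clauses for `Dh` ∧ `ℓ_p = 1` ∧ p07's LOWER ∧ Wuthrich's half (Thm. 16, published,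
NO image hypothesis) ⟹ `BranchPAdicGrossZagierAt W p Dh` — p255692's converse without `hS`.
[cite: Wuthrich2014, Thm. 16 (p. 397)] [cite: Delbourgo2002, Theorem (B) (p. 40)] [cite: Miller2011LMS, Def. 1.1] -/
theorem ClassX3Gord.branchPAdicGrossZagierAt_of_bsdp_of_chiBranchLower_of_wuthrichHalf_noRider
    (hWu : Wuthrich2014.thm16_halfEigenCharIdeal_dvd_cyclotomicPrime) (hmod : hasEntireLFunction_rat)
    (hX : ClassX3Gord W p) (hr : W.analyticRank = 1) (hna : ReductionNonAnomalous W p)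
    (hbsd : BSDp W p) (hdiv : ChiBranchLowerDivisibilityAt W p) {Dh : PAdicHeightData W p}
    (hB : LeadingTermClauses W p Dh) : BranchPAdicGrossZagierAt W p Dh := by
  intro V _ _ N _ f hp4 hVW hord hf ϖ hϖ
  have hp2 : p ≠ 2 := by omega
  have heven : Even (p / 2) := ⟨p / 4, by omega⟩
  obtain ⟨C, hC⟩ := hVW
  have hC' : C • V.quadraticTwist ((-1 : ℚ) ^ (p / 2) * p) = W := by
    rw [pStar_eq_self_of_mod_four_eq_one hp4]; exact hC
  obtain ⟨κ, γ, hκ, hγ, hγ', D, fE, hchar⟩ := exists_cyclotomic_dualData_generator W p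
  haveI : Module.Finite (IwasawaAlgebra p) D.X :=
    SelmerDualData.module_finite_of_isCyclotomic (W := W) (κ := κ) hκ D hγ
  have hj := padicValRat_j_nonneg_of_typeGOrd W p hX.typeGOrd
  have hϖ' : (if Even (p / 2) then (ϖ : ℝ) * V.realPeriodRat = plusPeriod f
      else (ϖ : ℝ) * V.imaginaryPeriodRat = minusPeriod f) := by
    rw [if_pos heven]; exact hϖ
  obtain ⟨hXt, g, hg, u, hι⟩ := isTorsion_and_exists_iota_eq_branch_of_wuthrichComponent W p
    (Wuthrich2014.charIdeal_dvd_padicLFunctionBranch_component_of_half hWu) hj hp2 V ⟨C, hC'⟩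
    (Or.inl hord) hX.classX3.1 hκ hγ hγ' hf D ϖ hϖ'
  rw [if_pos heven] at hι
  obtain ⟨h, hlow⟩ := hdiv V hp4 ⟨C, hC⟩ hord hκ hγ hγ' hf D ϖ hϖ fE
    (by rw [hchar]; exact Ideal.mem_span_singleton_self fE)
  exact exists_unit_pgz_of_lower_of_upper_of_bsdp_noRider hp2 hmod hr hbsd hB hna hκ hγ hγ' D hXt hchar hg
    hι hlow

/-- **RIDER-FREE CONVERSE on X3♯(G-ord) (reducible `E[p]`), ODD branch `p ≡ 3 (mod 4)` incl. `p = 3`,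
rank one.** [cite: Wuthrich2014, Thm. 16 (p. 397)] [cite: Delbourgo2002, Theorem (B) (p. 40)]
[cite: Miller2011LMS, Def. 1.1] -/
theorem ClassX3Gord.branchPAdicGrossZagierOddAt_of_bsdp_of_chiBranchLowerOdd_of_wuthrichHalf_noRider
    (hWu : Wuthrich2014.thm16_halfEigenCharIdeal_dvd_cyclotomicPrime) (hmod : hasEntireLFunction_rat)
    (hX : ClassX3Gord W p) (hr : W.analyticRank = 1) (hna : ReductionNonAnomalous W p)
    (hbsd : BSDp W p) (hdiv : ChiBranchLowerDivisibilityOddAt W p) {Dh : PAdicHeightData W p}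
    (hB : LeadingTermClauses W p Dh) : BranchPAdicGrossZagierOddAt W p Dh := by
  intro V _ _ N _ f hp4 hVW hord hf ϖ hϖ
  have hp2 : p ≠ 2 := by omega
  have hodd : ¬ Even (p / 2) := by
    rw [Nat.not_even_iff_odd]
    exact ⟨p / 4, by omega⟩
  obtain ⟨C, hC⟩ := hVW
  have hps : ((-1 : ℚ) ^ (p / 2) * (p : ℚ)) = -(p : ℚ) := by
    rw [pStar_eq_of_mod_four p (Or.inr hp4), if_neg (by omega)]
  have hC' : C • V.quadraticTwist ((-1 : ℚ) ^ (p / 2) * p) = W := by rw [hps]; exact hC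
  obtain ⟨κ, γ, hκ, hγ, hγ', D, fE, hchar⟩ := exists_cyclotomic_dualData_generator W p
  haveI : Module.Finite (IwasawaAlgebra p) D.X :=
    SelmerDualData.module_finite_of_isCyclotomic (W := W) (κ := κ) hκ D hγ
  have hj := padicValRat_j_nonneg_of_typeGOrd W p hX.typeGOrd
  have hϖ' : (if Even (p / 2) then (ϖ : ℝ) * V.realPeriodRat = plusPeriod f
      else (ϖ : ℝ) * V.imaginaryPeriodRat = minusPeriod f) := by
    rw [if_neg hodd]; exact hϖ
  obtain ⟨hXt, g, hg, u, hι⟩ := isTorsion_and_exists_iota_eq_branch_of_wuthrichComponent W p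
    (Wuthrich2014.charIdeal_dvd_padicLFunctionBranch_component_of_half hWu) hj hp2 V ⟨C, hC'⟩
    (Or.inl hord) hX.classX3.1 hκ hγ hγ' hf D ϖ hϖ'
  rw [if_neg hodd] at hι
  obtain ⟨h, hlow⟩ := hdiv V hp4 ⟨C, hC⟩ hord hκ hγ hγ' hf D ϖ hϖ fE
    (by rw [hchar]; exact Ideal.mem_span_singleton_self fE)
  exact exists_unit_pgz_of_lower_of_upper_of_bsdp_noRider hp2 hmod hr hbsd hB hna hκ hγ hγ' D hXt hchar hg
    hι hlow

end Summit.BirchSwinnertonDyer.Rank1Residual.Additive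

end
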